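import Mathlib
import HarnessLib
import Summits.Ventures.LatticeQCDFlow.Exactness.InvolutiveMetropolis

/-!
# PT-MetaD with a bias UPDATED between swaps: if the biased stream is re-equilibrated after each update, the measurement stream is exact at every time — for every adaptation rule

HONEST FRAMING: exact (Metropolis-corrected) sampling algorithms for lattice gauge theory;
figures of merit are autocorrelation/cost numbers at stated couplings and volumes; no
continuum-physics claim.

Venture `LatticeQCDFlow` (cell pub-lqcd), topic `Exactness`; FANOUT row 22 (`su3-ptbc`), PT-MetaD
arm E5 of its acceptance card (HOME `su3-ptbc/CARD-su3-ptbc.md` §6).  Companion of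
`PTMetaDSwap.lean` (STATIC bias: the pair chain is exact for `e^{−S(x)} vol ⊗ e^{−S(y) − V(Q y)} vol`,
so the measurement stream `x` has the physical law).  In the metadynamics BUILD-UP phase the bias is
not static: it is updated from the biased stream's own trajectory between exchange proposals (the
first 4D `SU(3)` run of Eichhorn–Fuwa–Hoelbling–Varnhorst, arXiv:2307.04742 §VI.B, «a MetaD-HMC
stream that dynamically generates the bias potential», named only), and the pair process is no longer
a time-homogeneous chain with a known invariant law.  NEW WORK of the cell over the tree's
`InvolutiveMetropolis.lean` (`involMH`, `involMH_invariant`: a reference-measure-preserving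
involution, Metropolis-tested for ANY measurable energy, is exact) and Mathlib's kernel / product
measure API; nothing here is cited as a fact.

## The typed protocol (one round; state `(x, v)` = (measurement configuration, bias index))

`Ω` one stream's configurations with reference measure `vol`; `S : Ω → ℝ` the physical action;
`𝓥` ANY measurable space of bias indices (it may record the whole history) and `B : 𝓥 → Ω → ℝ` the
bias family (`B v = V_v ∘ Q`, jointly measurable); `F : 𝓥 × Ω → 𝓥` ANY measurable update rule (new
bias from the old one and the biased stream's configuration after the exchange step).  One round
`adaptiveRound` = (D) the bias in force is `v`; (Y) REDRAW the biased stream from its law at the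
current bias, `y ∼ e^{−S − B v} vol` (`biasedKernel`; the exact re-equilibration — an idealisation of
«enough MetaD-HMC trajectories at fixed bias»); (S) the exchange `(x, y) ↦ (y, x)` Metropolis-tested
with the CURRENT bias, acceptance `min {1, e^{B v y − B v x}}` (`adaptiveSwap`, `involAccept_adaptive`:
the physical action cancels, as in the static case); (U) update `v ↦ F (v, y')` from the biased
stream's post-exchange configuration `y'`, forget `y'`.

## Results

* §2 `adaptiveSwap S B` is ONE deterministic-involution Metropolis kernel on `Ω × (𝓥 × Ω)` for the
  energy `S x + S y + B v y` and the involution `(x, (v, y)) ↦ (y, (v, x))`, which preserves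
  `vol ⊗ (m ⊗ vol)` for every s-finite `m` (`measurePreserving_adaptiveSwapMap`); hence
  **`adaptiveSwap_invariant`**: for EVERY s-finite law `m` of the bias index, the law
  `redrawLaw m = e^{−S(x) − S(y) − B v y} (vol ⊗ m ⊗ vol)` — "`x` physical and independent of
  `(v, y)`, `y` equilibrated at bias `v`" — is invariant under the exchange step.
* §3 `redrawLaw_eq_prod`: `redrawLaw m = (e^{−S} vol) ⊗ (m ⊗ₘ biasedKernel)`; `redraw_comp_prod`: step
  (Y) maps `(e^{−S} vol) ⊗ m` to `redrawLaw m`; `redrawLaw_map_update`: step (U) maps `redrawLaw m` to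
  `(e^{−S} vol) ⊗ m'` with `m' = biasStep m := (m ⊗ₘ biasedKernel).map F`.
* §4 **`adaptiveRound_comp_prod`**: one round maps `(e^{−S} vol) ⊗ m` to `(e^{−S} vol) ⊗ biasStep m`;
  **`adaptiveRound_iterate`**: after `t` rounds from `(e^{−S} vol) ⊗ m₀` the joint law is
  `(e^{−S} vol) ⊗ (biasStep^[t] m₀)` — THE MEASUREMENT STREAM IS EXACTLY PHYSICAL AND INDEPENDENT OF
  THE BIAS AT EVERY TIME, WHATEVER THE ADAPTATION RULE `F`; `measurement_update_comp_prod`: an exact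
  in-stream update of `x` (1HB+4OR) in between changes nothing; **`adaptiveRound_iterate_fst`**: with
  normalised laws (`B v` containing its `log Z_v`, which does not change the swap test) the
  measurement marginal after `t` rounds IS the physical law.

## Not here (and false in general)

Exactness WITHOUT step (Y)'s re-equilibration — i.e. with the biased stream updated by finitely many
exact-for-the-current-bias moves, or with the bias updated AFTER the redraw and BEFORE the exchange
(the literal metadynamics order) — FAILS: explicit two-state witnesses in the companion
`PTMetaDAdaptiveWitness.lean`.  Asymptotic statements (diminishing adaptation, convergence of the
bias) are not claimed either way; nothing numerical.
-/

noncomputable section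

namespace Summit.Ventures.LatticeQCDFlow.Exactness

open MeasureTheory ProbabilityTheory Real
open scoped ENNReal ProbabilityTheory

variable {Ω : Type*} [MeasurableSpace Ω] {𝓥 : Type*} [MeasurableSpace 𝓥]

/-! ## §1 The state space `Ω × (𝓥 × Ω)` during a round and the exchange map -/

/-- The exchange on `(x, (v, y))` = (measurement configuration, (bias index, biased configuration)):
swap the two configurations, keep the bias. -/
def adaptiveSwapMap (z : Ω × (𝓥 × Ω)) : Ω × (𝓥 × Ω) := (z.2.2, (z.2.1, z.1))

omit [MeasurableSpace Ω] [MeasurableSpace 𝓥] in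
/-- Unfolding lemma. -/
@[simp] theorem adaptiveSwapMap_apply (x y : Ω) (v : 𝓥) :
    adaptiveSwapMap (x, (v, y)) = (y, (v, x)) := rfl

omit [MeasurableSpace Ω] [MeasurableSpace 𝓥] in
/-- The exchange is an involution. -/
theorem adaptiveSwapMap_involutive : Function.Involutive (adaptiveSwapMap (Ω := Ω) (𝓥 := 𝓥)) :=
  fun _ => rfl

/-- The exchange is measurable. -/
theorem measurable_adaptiveSwapMap : Measurable (adaptiveSwapMap (Ω := Ω) (𝓥 := 𝓥)) :=
  (measurable_snd.comp measurable_snd).prodMk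
    ((measurable_fst.comp measurable_snd).prodMk measurable_fst)

/-- **The exchange preserves `vol ⊗ (m ⊗ vol)` for EVERY s-finite law `m` of the bias index** (it is a
coordinate permutation fixing the bias coordinate). -/
theorem measurePreserving_adaptiveSwapMap (vol : Measure Ω) [SFinite vol] (m : Measure 𝓥) [SFinite m] :
    MeasurePreserving adaptiveSwapMap (vol.prod (m.prod vol)) (vol.prod (m.prod vol)) := by
  have h : (adaptiveSwapMap : Ω × (𝓥 × Ω) → Ω × (𝓥 × Ω)) =
      Prod.map id Prod.swap ∘ Prod.swap ∘ (MeasurableEquiv.prodAssoc (α := Ω) (β := 𝓥) (γ := Ω)).symm := by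
    funext z
    rfl
  rw [h]
  exact (((MeasurePreserving.id vol).prod (Measure.measurePreserving_swap (μ := vol) (ν := m))).comp
    (Measure.measurePreserving_swap (μ := vol.prod m) (ν := vol))).comp
      ((measurePreserving_prodAssoc vol m vol).symm MeasurableEquiv.prodAssoc)

/-! ## §2 The exchange step with the CURRENT bias, as one exact kernel on the triple space -/

section Swap

variable (S : Ω → ℝ) (B : 𝓥 → Ω → ℝ)

/-- The pair energy at the current bias: `S x + (S y + B v y)` for the state `(x, (v, y))`. -/
def adaptiveEnergy (z : Ω × (𝓥 × Ω)) : ℝ := S z.1 + (S z.2.2 + B z.2.1 z.2.2)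

/-- **The exchange step of adaptive PT-MetaD**: propose `(x, (v, y)) ↦ (y, (v, x))`, accept with the
Metropolis probability for the pair energy AT THE CURRENT BIAS `v` — the tree's `involMH`. -/
def adaptiveSwap : Kernel (Ω × (𝓥 × Ω)) (Ω × (𝓥 × Ω)) :=
  involMH adaptiveSwapMap measurable_adaptiveSwapMap (adaptiveEnergy S B)

omit [MeasurableSpace Ω] [MeasurableSpace 𝓥] in
/-- **The test sees only the current bias**: acceptance `min {1, exp (B v y − B v x)}`; the physical
action cancels (as in `PTMetaDSwap.involAccept_ptMetaD`). -/
theorem involAccept_adaptive (x y : Ω) (v : 𝓥) :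
    involAccept (adaptiveEnergy S B) adaptiveSwapMap (x, (v, y)) = min 1 (Real.exp (B v y - B v x)) := by
  simp only [involAccept, adaptiveEnergy, adaptiveSwapMap_apply]
  congr 2
  ring

omit [MeasurableSpace Ω] [MeasurableSpace 𝓥] in
/-- Adding a bias-index-dependent constant to the bias (e.g. `log Z_v`, normalising each biased law)
does not change the test. -/
theorem involAccept_adaptive_add_const (c : 𝓥 → ℝ) (z : Ω × (𝓥 × Ω)) :
    involAccept (adaptiveEnergy S fun v y => B v y + c v) adaptiveSwapMap z =
      involAccept (adaptiveEnergy S B) adaptiveSwapMap z := by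
  obtain ⟨x, v, y⟩ := z
  rw [involAccept_adaptive, involAccept_adaptive]
  congr 2
  ring

variable {S B}

/-- Measurability of the pair energy. -/
theorem measurable_adaptiveEnergy (hS : Measurable S) (hB : Measurable (Function.uncurry B)) :
    Measurable (adaptiveEnergy S B) :=
  (hS.comp measurable_fst).add
    ((hS.comp (measurable_snd.comp measurable_snd)).add (hB.comp measurable_snd))

/-- The exchange step is a Markov kernel. -/
instance isMarkovKernel_adaptiveSwap [Fact (Measurable (adaptiveEnergy S B))] :
    IsMarkovKernel (adaptiveSwap S B) := by
  unfold adaptiveSwap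
  infer_instance

end Swap

/-! ## §3 Re-equilibration of the biased stream: the redraw kernel and the laws `e^{−S} vol ⊗ ν` -/

section Redraw

variable (vol : Measure Ω) (S : Ω → ℝ) (B : 𝓥 → Ω → ℝ)

/-- **The law during a round** when the bias index has law `m`: density `e^{−(S x + S y + B v y)}`
against `vol ⊗ (m ⊗ vol)` — `x` physical and independent of `(v, y)`, `y` equilibrated at `v`. -/
def redrawLaw (m : Measure 𝓥) : Measure (Ω × (𝓥 × Ω)) :=
  (vol.prod (m.prod vol)).withDensity fun z => ENNReal.ofReal (Real.exp (-(adaptiveEnergy S B z)))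

variable [SFinite vol]

/-- **The redraw kernel** (s-finite reference measure): at bias index `v`, the biased stream's law
`e^{−S − B v} vol` (un-normalised; put `log Z_v` into `B v` to normalise —
`involAccept_adaptive_add_const`). -/
def biasedKernel : Kernel 𝓥 Ω :=
  (Kernel.const 𝓥 vol).withDensity fun v y => ENNReal.ofReal (Real.exp (-(S y + B v y)))

variable {vol S B}

/-- The redraw kernel is s-finite. -/
instance isSFiniteKernel_biasedKernel : IsSFiniteKernel (biasedKernel vol S B) := by
  unfold biasedKernel
  exact Kernel.IsSFiniteKernel.withDensity _ fun _ _ => ENNReal.ofReal_ne_top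

/-- The mixture `m ⊗ₘ biasedKernel` has density `e^{−(S y + B v y)}` against `m ⊗ vol`. -/
theorem compProd_biasedKernel (hS : Measurable S) (hB : Measurable (Function.uncurry B))
    (m : Measure 𝓥) [SFinite m] :
    m ⊗ₘ biasedKernel vol S B =
      (m.prod vol).withDensity fun p => ENNReal.ofReal (Real.exp (-(S p.2 + B p.1 p.2))) := by
  have hf : Measurable (Function.uncurry fun (v : 𝓥) (y : Ω) =>
      ENNReal.ofReal (Real.exp (-(S y + B v y)))) :=
    (measurable_exp.comp ((hS.comp measurable_snd).add hB).neg).ennreal_ofReal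
  haveI : IsSFiniteKernel ((Kernel.const 𝓥 vol).withDensity fun v y =>
      ENNReal.ofReal (Real.exp (-(S y + B v y)))) :=
    Kernel.IsSFiniteKernel.withDensity _ fun _ _ => ENNReal.ofReal_ne_top
  unfold biasedKernel
  rw [Measure.compProd_withDensity hf, Measure.compProd_const]

/-- **`redrawLaw m = (e^{−S} vol) ⊗ (m ⊗ₘ biasedKernel)`**: the measurement configuration is
physical and independent of (bias, biased configuration). -/
theorem redrawLaw_eq_prod (hS : Measurable S) (hB : Measurable (Function.uncurry B))
    (m : Measure 𝓥) [SFinite m] :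
    redrawLaw vol S B m =
      (vol.withDensity fun x => ENNReal.ofReal (Real.exp (-S x))).prod (m ⊗ₘ biasedKernel vol S B) := by
  have h1 : Measurable fun x : Ω => ENNReal.ofReal (Real.exp (-S x)) :=
    (measurable_exp.comp hS.neg).ennreal_ofReal
  have h2 : Measurable fun p : 𝓥 × Ω => ENNReal.ofReal (Real.exp (-(S p.2 + B p.1 p.2))) :=
    (measurable_exp.comp ((hS.comp measurable_snd).add hB).neg).ennreal_ofReal
  rw [compProd_biasedKernel hS hB, prod_withDensity h1 h2, redrawLaw]
  congr 1
  funext z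
  rw [← ENNReal.ofReal_mul (Real.exp_pos _).le, ← Real.exp_add, adaptiveEnergy]
  congr 2
  ring

/-- The law during a round is s-finite. -/
instance sFinite_redrawLaw (m : Measure 𝓥) [SFinite m] : SFinite (redrawLaw vol S B m) := by
  unfold redrawLaw
  infer_instance

/-- **Step (Y)**: redrawing the biased stream at the current bias maps the state law
`(e^{−S} vol) ⊗ m` to `redrawLaw m`. -/
theorem redraw_comp_prod (hS : Measurable S) (hB : Measurable (Function.uncurry B))
    (m : Measure 𝓥) [SFinite m] :
    (Kernel.id ∥ₖ (Kernel.id ×ₖ biasedKernel vol S B)) ∘ₘ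
        ((vol.withDensity fun x => ENNReal.ofReal (Real.exp (-S x))).prod m) =
      redrawLaw vol S B m := by
  rw [redrawLaw_eq_prod hS hB, Measure.compProd_eq_comp_prod, Measure.prod_comp_right]

/-- **Step (U)**: updating the bias from the biased stream's configuration by ANY measurable rule `F`
and forgetting that configuration maps `redrawLaw m` to `(e^{−S} vol) ⊗ ((m ⊗ₘ biasedKernel).map F)`. -/
theorem redrawLaw_map_update (hS : Measurable S) (hB : Measurable (Function.uncurry B))
    (m : Measure 𝓥) [SFinite m] {F : 𝓥 × Ω → 𝓥} (hF : Measurable F) :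
    (redrawLaw vol S B m).map (Prod.map id F) =
      (vol.withDensity fun x => ENNReal.ofReal (Real.exp (-S x))).prod
        ((m ⊗ₘ biasedKernel vol S B).map F) := by
  rw [redrawLaw_eq_prod hS hB, ← Measure.map_prod_map _ _ measurable_id hF, Measure.map_id]

end Redraw

/-! ## §4 Invariance under the exchange, the round, and all times -/

section Round

variable {vol : Measure Ω} [SFinite vol] {S : Ω → ℝ} {B : 𝓥 → Ω → ℝ}

/-- **Step (S) — the exchange with the current bias leaves EVERY `redrawLaw m` invariant**
(`involMH_invariant` on the triple space: the involution preserves `vol ⊗ (m ⊗ vol)` and the energy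
is `S x + S y + B v y`). -/
theorem adaptiveSwap_invariant (hS : Measurable S) (hB : Measurable (Function.uncurry B))
    (m : Measure 𝓥) [SFinite m] :
    Kernel.Invariant (adaptiveSwap S B) (redrawLaw vol S B m) :=
  involMH_invariant (measurable_adaptiveEnergy hS hB) adaptiveSwapMap_involutive
    (measurePreserving_adaptiveSwapMap vol m)

variable (vol S B) in
/-- **One round of adaptive PT-MetaD** on the state `(x, v)`: (Y) redraw the biased stream at the
current bias, (S) exchange step with the current bias, (U) bias update `v ↦ F (v, y')` from the biased
stream's post-exchange configuration, which is then forgotten. -/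
def adaptiveRound (F : 𝓥 × Ω → 𝓥) (hF : Measurable F) : Kernel (Ω × 𝓥) (Ω × 𝓥) :=
  Kernel.deterministic (Prod.map id F) (measurable_id.prodMap hF) ∘ₖ
    (adaptiveSwap S B ∘ₖ (Kernel.id ∥ₖ (Kernel.id ×ₖ biasedKernel vol S B)))

variable (vol S B) in
/-- The induced update of the bias-index law: `m ↦ ((m ⊗ₘ biasedKernel).map F)`. -/
def biasStep (F : 𝓥 × Ω → 𝓥) (m : Measure 𝓥) : Measure 𝓥 :=
  (m ⊗ₘ biasedKernel vol S B).map F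

/-- The bias-index law stays s-finite. -/
instance sFinite_biasStep (F : 𝓥 × Ω → 𝓥) (m : Measure 𝓥) [SFinite m] :
    SFinite (biasStep vol S B F m) := by
  unfold biasStep
  infer_instance

/-- **ONE ROUND KEEPS THE MEASUREMENT STREAM PHYSICAL AND INDEPENDENT OF THE BIAS**: for every
s-finite bias-index law `m` and every measurable update rule `F`,
`adaptiveRound ∘ₘ ((e^{−S} vol) ⊗ m) = (e^{−S} vol) ⊗ biasStep m`. -/
theorem adaptiveRound_comp_prod (hS : Measurable S) (hB : Measurable (Function.uncurry B))
    {F : 𝓥 × Ω → 𝓥} (hF : Measurable F) (m : Measure 𝓥) [SFinite m] :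
    adaptiveRound vol S B F hF ∘ₘ ((vol.withDensity fun x => ENNReal.ofReal (Real.exp (-S x))).prod m) =
      (vol.withDensity fun x => ENNReal.ofReal (Real.exp (-S x))).prod (biasStep vol S B F m) := by
  rw [adaptiveRound, ← Measure.comp_assoc, ← Measure.comp_assoc, redraw_comp_prod hS hB,
    (adaptiveSwap_invariant hS hB m).def, Measure.deterministic_comp_eq_map,
    redrawLaw_map_update hS hB m hF, biasStep]

/-- **ALL TIMES**: after `t` rounds started from `(e^{−S} vol) ⊗ m₀` (measurement stream physical and
independent of the initial bias), the joint law is `(e^{−S} vol) ⊗ (biasStep^[t] m₀)` — the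
measurement stream is exactly physical, and independent of the current bias, at every time and for
every adaptation rule. -/
theorem adaptiveRound_iterate (hS : Measurable S) (hB : Measurable (Function.uncurry B))
    {F : 𝓥 × Ω → 𝓥} (hF : Measurable F) (m₀ : Measure 𝓥) [SFinite m₀] (t : ℕ) :
    (fun μ : Measure (Ω × 𝓥) => adaptiveRound vol S B F hF ∘ₘ μ)^[t]
          ((vol.withDensity fun x => ENNReal.ofReal (Real.exp (-S x))).prod m₀) =
        (vol.withDensity fun x => ENNReal.ofReal (Real.exp (-S x))).prod ((biasStep vol S B F)^[t] m₀) ∧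
      SFinite ((biasStep vol S B F)^[t] m₀) := by
  induction t with
  | zero => exact ⟨rfl, (show SFinite m₀ from inferInstance)⟩
  | succ t ih =>
    obtain ⟨h, hinst⟩ := ih
    refine ⟨?_, ?_⟩
    · rw [Function.iterate_succ_apply', h, Function.iterate_succ_apply']
      exact adaptiveRound_comp_prod hS hB hF _
    · rw [Function.iterate_succ_apply']
      infer_instance

/-- **An exact in-stream update of the measurement stream changes nothing**: if `K` leaves
`e^{−S} vol` invariant (heat bath / over-relaxation sweeps), applying it to the measurement slot maps
`(e^{−S} vol) ⊗ m` to itself. -/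
theorem measurement_update_comp_prod {K : Kernel Ω Ω} [IsSFiniteKernel K]
    (hK : Kernel.Invariant K (vol.withDensity fun x => ENNReal.ofReal (Real.exp (-S x))))
    (m : Measure 𝓥) [SFinite m] :
    (K ∥ₖ Kernel.id) ∘ₘ ((vol.withDensity fun x => ENNReal.ofReal (Real.exp (-S x))).prod m) =
      (vol.withDensity fun x => ENNReal.ofReal (Real.exp (-S x))).prod m := by
  rw [← Measure.prod_comp_left, hK.def]

/-- **Normalised reading**: if the physical law is a probability law and every biased law
`biasedKernel v` is one (put `log Z_v` into `B v`; the swap test is unchanged,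
`involAccept_adaptive_add_const`), then each round is a Markov kernel on `(x, v)`, the bias-index laws
`biasStep^[t] m₀` are probability laws, and THE MEASUREMENT MARGINAL AFTER `t` ROUNDS IS THE PHYSICAL
LAW. -/
theorem adaptiveRound_iterate_fst (hS : Measurable S) (hB : Measurable (Function.uncurry B))
    {F : 𝓥 × Ω → 𝓥} (hF : Measurable F)
    [IsProbabilityMeasure (vol.withDensity fun x => ENNReal.ofReal (Real.exp (-S x)))]
    [IsMarkovKernel (biasedKernel vol S B)] (m₀ : Measure 𝓥) [IsProbabilityMeasure m₀] (t : ℕ) :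
    IsProbabilityMeasure ((biasStep vol S B F)^[t] m₀) ∧
      ((fun μ : Measure (Ω × 𝓥) => adaptiveRound vol S B F hF ∘ₘ μ)^[t]
          ((vol.withDensity fun x => ENNReal.ofReal (Real.exp (-S x))).prod m₀)).fst =
        (vol.withDensity fun x => ENNReal.ofReal (Real.exp (-S x))) := by
  have hprob : ∀ n, IsProbabilityMeasure ((biasStep vol S B F)^[n] m₀) := by
    intro n
    induction n with
    | zero => exact (show IsProbabilityMeasure m₀ from inferInstance)
    | succ n ih =>
      rw [Function.iterate_succ_apply']
      haveI := ih
      show IsProbabilityMeasure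
        (Measure.map F (((biasStep vol S B F)^[n] m₀) ⊗ₘ biasedKernel vol S B))
      exact Measure.isProbabilityMeasure_map hF.aemeasurable
  refine ⟨hprob t, ?_⟩
  haveI := hprob t
  rw [(adaptiveRound_iterate hS hB hF m₀ t).1, Measure.fst_prod]

end Round

end Summit.Ventures.LatticeQCDFlow.Exactness

end
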